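import Summits.CriticalPhenomena.PercolationContinuityZ3.Theorems.PercNearOneGluingNoHeavyLowerTailSahiSymCubeFiveEight
import Summits.CriticalPhenomena.PercolationContinuityZ3.Theorems.PercNearOneGluingNoHeavyLowerTailSahiSymCubeMemo
import Summits.CriticalPhenomena.PercolationContinuityZ3.Theorems.PercNearOneGluingNoHeavyLowerTailSahiSymCubeFive9A
import Summits.CriticalPhenomena.PercolationContinuityZ3.Theorems.PercNearOneGluingNoHeavyLowerTailSahiSymCubeFive9B
import Summits.CriticalPhenomena.PercolationContinuityZ3.Theorems.PercNearOneGluingNoHeavyLowerTailSahiSymCubeFive9C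
import Summits.CriticalPhenomena.PercolationContinuityZ3.Theorems.PercNearOneGluingNoHeavyLowerTailSahiSymCubeFive9D

/-!
# SAHI'S `C_9` ON THE CUBE `{0,1}^5` FOR EVERY PRODUCT MEASURE (Lean): assembly of the symmetry-reduced coloured-antichain check of order 9

Support file (cell `prim-sahi`, seat `prim-sahi-typer` gen 29; `--supports stmt-CriticalPhenomena-4575`).  Pure proofs; closure = standard axioms
+ the `native_decide` axioms of the computational chunks …`SahiSymCubeFive9A–D` (6 order-9 digit tests with the memoised
recursion `testM`, one coloured antichain per orbit of `S_5 × S_9`) + those behind …`SahiSymCubeFiveEight` (orders `≤ 8`).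

* `symCheckT_five_nine` : `symCheckT 5 9 (testM 5 9 65) = true`;
* **`sahiPositive_bernoulliWeight_nine_fin_five`**: `SahiPositive (bernoulliWeight p) 9` for every `p : Fin 5 → [0,1]` (Sahi's `C_9` for five
  independent coins); `sahiC9_cube_five` — events form; `sahiPositive_bernoulliWeight_fin_five_of_le_nine` — every order `n ≤ 9`. [this work]
-/

namespace Summit.CriticalPhenomena.PercolationContinuityZ3.Theorems.SahiSymCube

open Literature.Combinatorics.Sahi2008
open Literature.Probability.Percolation.DecisionTree (ind)

/-- **The order-9 symmetry-reduced check on `{0,1}^5` (memoised leaf test) passes** (assembled from the computational chunks). [this work] -/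
theorem symCheckT_five_nine : symCheckT 5 9 (testM 5 9 65) = true :=
  symCheck_of_from (symCheckFrom_of_range symCheck_five_9_chunkA
    (symCheckFrom_of_range symCheck_five_9_chunkB
    (symCheckFrom_of_range symCheck_five_9_chunkC symCheck_five_9_chunkD)))

/-- **SAHI'S `C_9` FOR FIVE INDEPENDENT COINS**: `SahiPositive (bernoulliWeight p) 9` for every `p : Fin 5 → [0,1]`. [this work] -/
theorem sahiPositive_bernoulliWeight_nine_fin_five (p : Fin 5 → unitInterval) : SahiPositive (bernoulliWeight p) 9 :=
  sahiPositive_of_symCheckT (n := 7) (fun A hA p' => testM_sound A hA p') symCheckT_five_nine p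
    fun _ _ hk => sahiPositive_bernoulliWeight_fin_five_of_le_eight p hk

/-- **Sahi's `C_9` on `{0,1}^5`, events form**: `E_9(μ_p; A) ≥ 0` for increasing events under every product measure. [this work] -/
theorem sahiC9_cube_five (p : Fin 5 → unitInterval) {A : Fin 9 → Set (Set (Fin 5))} (hA : ∀ i, IsUpperSet (A i)) :
    0 ≤ sahiE (bernoulliWeight p) 9 (fun i => ind (A i)) :=
  sahiPositive_bernoulliWeight_nine_fin_five p _ (fun _ _ => Literature.Probability.Percolation.DecisionTree.ind_nonneg _ _)
    (fun i => monotone_ind_of_isUpperSet (hA i))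

/-- **Sahi's conjecture at every order `n ≤ 9` for five independent coins.** [this work] -/
theorem sahiPositive_bernoulliWeight_fin_five_of_le_nine (p : Fin 5 → unitInterval) {n : ℕ} (hn : n ≤ 9) :
    SahiPositive (bernoulliWeight p) n := by
  rcases Nat.lt_or_ge n 9 with h | h
  · exact sahiPositive_bernoulliWeight_fin_five_of_le_eight p (by omega)
  · have : n = 9 := le_antisymm hn h
    subst this
    exact sahiPositive_bernoulliWeight_nine_fin_five p

end Summit.CriticalPhenomena.PercolationContinuityZ3.Theorems.SahiSymCube
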